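import Mathlib
import Summits.MatrixMultiplication.MatrixMultiplication.Theorems.SubgroupIdentityDesigns.Negative.NormOneTorus

/-!
# Cross-member orbit pairs: a member containing a full Singer cycle (all `p`)

Route `LevelGradedCohnUmans`, crux `SubgroupIdentityDesigns`, the `(m,k) = (2,1)` cell, `p`-free
case.

If a subgroup `K` of one member acts FREELY AND TRANSITIVELY on the non-zero vectors (a full Singer
cycle `C_{p²-1}`; there is a single `K`-orbit), then ANY element `k₀ ∉ K` re-indexes `{k a : k ∈ K}`
(`orbitPair_of_transitive`), and `k₀` may be taken in ANOTHER member: the translate `k₀ K` then lies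
in the triple-product set.  Consequences (`no_levelOne_design_of_transitive₂₁/₃₁/₃₂`): a triple with
`K ≤ H₂` (resp. `H₃`) and a non-trivial element of `H₁` (resp. `H₁` or `H₂`) outside `K` carries no
level-`1` identity design — all `p`, no TPP and no volume hypothesis (under TPP the members are
pairwise disjoint, so any `k₀ ≠ 1` of the other member qualifies).  This covers the CYCLIC `p`-free
members `C_ns` observed above the floor at `p = 5` (class 34, profiles `(6,24,6)`, `(6,6,24)`),
which contain no copy of `O₂⁻(𝔽_p)` and so escape `NormOneTorus`.  VALUE = THEOREM, NOT summit
progress; the crux item stmt-MatrixMultiplication-14079 is untouched and remains open.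
-/

set_option linter.dupNamespace false

noncomputable section

open scoped BigOperators Classical

open Summit.MatrixMultiplication.MatrixMultiplication.Theorems.LieRankDesigns.Negative (GLm Mat)

namespace Summit.MatrixMultiplication.MatrixMultiplication.Theorems.SubgroupIdentityDesigns.Negative

section TransitiveTorus

variable {p : ℕ} [hp : Fact p.Prime]

/-- **Free + transitive ⇒ orbit pair with ANY `k₀`.** -/
theorem orbitPair_of_transitive (K : Subgroup (GLm p 2)) (k₀ : GLm p 2)
    (hfree : ∀ a : Fin 2 → ZMod p, a ≠ 0 → ∀ k ∈ K, ∀ k' ∈ K,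
      ((k : GLm p 2) : Mat p 2).mulVec a = ((k' : GLm p 2) : Mat p 2).mulVec a → k = k')
    (htrans : ∀ a : Fin 2 → ZMod p, a ≠ 0 → ∀ v : Fin 2 → ZMod p, v ≠ 0 → ∃ k ∈ K,
      ((k : GLm p 2) : Mat p 2).mulVec a = v)
    (a : Fin 2 → ZMod p) (ha : a ≠ 0) :
    ∃ e : (K : Set (GLm p 2)).toFinset ≃ (K : Set (GLm p 2)).toFinset,
      ∀ k : (K : Set (GLm p 2)).toFinset,
        ((k₀ * (e k : GLm p 2) : GLm p 2) : Mat p 2).mulVec a =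
          ((k : GLm p 2) : Mat p 2).mulVec a := by
  refine orbitPair_of_free K k₀ hfree (fun a ha k _ => ?_) a ha
  -- target vector `k₀⁻¹ k a ≠ 0`
  have hv : ((k₀⁻¹ * k : GLm p 2) : Mat p 2).mulVec a ≠ 0 := by
    intro h0
    apply ha
    have := congrArg (((k₀⁻¹ * k)⁻¹ : GLm p 2) : Mat p 2).mulVec h0
    rwa [Matrix.mulVec_mulVec, Matrix.mulVec_zero, ← Units.val_mul, inv_mul_cancel, Units.val_one,
      Matrix.one_mulVec] at this
  obtain ⟨k', hk', e⟩ := htrans a ha _ hv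
  refine ⟨k', hk', ?_⟩
  rw [Units.val_mul, ← Matrix.mulVec_mulVec, e, Matrix.mulVec_mulVec, ← Units.val_mul, ← mul_assoc,
    mul_inv_cancel, one_mul]

/-- **`K ≤ H₂` free and transitive, `k₀ ∈ H₁ ∖ K`, `k₀ ≠ 1` ⇒ no level-one identity design.** -/
theorem no_levelOne_design_of_transitive₂₁ {H₁ H₂ H₃ : Subgroup (GLm p 2)}
    (K : Subgroup (GLm p 2)) (hKH : K ≤ H₂) (k₀ : GLm p 2) (hk₀ : k₀ ∈ H₁) (hk₀K : k₀ ∉ K)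
    (hfree : ∀ a : Fin 2 → ZMod p, a ≠ 0 → ∀ k ∈ K, ∀ k' ∈ K,
      ((k : GLm p 2) : Mat p 2).mulVec a = ((k' : GLm p 2) : Mat p 2).mulVec a → k = k')
    (htrans : ∀ a : Fin 2 → ZMod p, a ≠ 0 → ∀ v : Fin 2 → ZMod p, v ≠ 0 → ∃ k ∈ K,
      ((k : GLm p 2) : Mat p 2).mulVec a = v) :
    ¬ ∃ c : Mat p 2 → ℂ, (∀ M, 1 < M.rank → c M = 0) ∧
      (∑ M, c M * ZMod.stdAddChar (Matrix.trace (M * ((1 : GLm p 2) : Mat p 2)))) = 1 ∧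
      ∀ a ∈ H₁, ∀ b ∈ H₂, ∀ g ∈ H₃, a * b * g ≠ 1 →
        (∑ M, c M *
          ZMod.stdAddChar (Matrix.trace (M * ((a * b * g : GLm p 2) : Mat p 2)))) = 0 := by
  have hmem : ∀ {k : GLm p 2}, k ∈ (K : Set (GLm p 2)).toFinset ↔ k ∈ K := fun {k} => by
    rw [Set.mem_toFinset]; rfl
  refine no_levelOne_design_of_orbit_pair (K : Set (GLm p 2)).toFinset k₀ (hmem.mpr K.one_mem)
    (fun k hk e => hk₀K ?_) (fun k hk _ => ⟨1, H₁.one_mem, k, hKH (hmem.mp hk), 1, H₃.one_mem,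
      by rw [one_mul, mul_one]⟩)
    (fun k hk => ⟨k₀, hk₀, k, hKH (hmem.mp hk), 1, H₃.one_mem, by rw [mul_one]⟩)
    (orbitPair_of_transitive K k₀ hfree htrans)
  rw [eq_inv_of_mul_eq_one_left e]
  exact K.inv_mem (hmem.mp hk)

/-- **`K ≤ H₃` free and transitive, `k₀ ∈ H₁ ∖ K` ⇒ no level-one identity design.** -/
theorem no_levelOne_design_of_transitive₃₁ {H₁ H₂ H₃ : Subgroup (GLm p 2)}
    (K : Subgroup (GLm p 2)) (hKH : K ≤ H₃) (k₀ : GLm p 2) (hk₀ : k₀ ∈ H₁) (hk₀K : k₀ ∉ K)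
    (hfree : ∀ a : Fin 2 → ZMod p, a ≠ 0 → ∀ k ∈ K, ∀ k' ∈ K,
      ((k : GLm p 2) : Mat p 2).mulVec a = ((k' : GLm p 2) : Mat p 2).mulVec a → k = k')
    (htrans : ∀ a : Fin 2 → ZMod p, a ≠ 0 → ∀ v : Fin 2 → ZMod p, v ≠ 0 → ∃ k ∈ K,
      ((k : GLm p 2) : Mat p 2).mulVec a = v) :
    ¬ ∃ c : Mat p 2 → ℂ, (∀ M, 1 < M.rank → c M = 0) ∧
      (∑ M, c M * ZMod.stdAddChar (Matrix.trace (M * ((1 : GLm p 2) : Mat p 2)))) = 1 ∧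
      ∀ a ∈ H₁, ∀ b ∈ H₂, ∀ g ∈ H₃, a * b * g ≠ 1 →
        (∑ M, c M *
          ZMod.stdAddChar (Matrix.trace (M * ((a * b * g : GLm p 2) : Mat p 2)))) = 0 := by
  have hmem : ∀ {k : GLm p 2}, k ∈ (K : Set (GLm p 2)).toFinset ↔ k ∈ K := fun {k} => by
    rw [Set.mem_toFinset]; rfl
  refine no_levelOne_design_of_orbit_pair (K : Set (GLm p 2)).toFinset k₀ (hmem.mpr K.one_mem)
    (fun k hk e => hk₀K ?_) (fun k hk _ => ⟨1, H₁.one_mem, 1, H₂.one_mem, k, hKH (hmem.mp hk),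
      by rw [one_mul, one_mul]⟩)
    (fun k hk => ⟨k₀, hk₀, 1, H₂.one_mem, k, hKH (hmem.mp hk), by rw [mul_one]⟩)
    (orbitPair_of_transitive K k₀ hfree htrans)
  rw [eq_inv_of_mul_eq_one_left e]
  exact K.inv_mem (hmem.mp hk)

/-- **`K ≤ H₃` free and transitive, `k₀ ∈ H₂ ∖ K` ⇒ no level-one identity design.** -/
theorem no_levelOne_design_of_transitive₃₂ {H₁ H₂ H₃ : Subgroup (GLm p 2)}
    (K : Subgroup (GLm p 2)) (hKH : K ≤ H₃) (k₀ : GLm p 2) (hk₀ : k₀ ∈ H₂) (hk₀K : k₀ ∉ K)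
    (hfree : ∀ a : Fin 2 → ZMod p, a ≠ 0 → ∀ k ∈ K, ∀ k' ∈ K,
      ((k : GLm p 2) : Mat p 2).mulVec a = ((k' : GLm p 2) : Mat p 2).mulVec a → k = k')
    (htrans : ∀ a : Fin 2 → ZMod p, a ≠ 0 → ∀ v : Fin 2 → ZMod p, v ≠ 0 → ∃ k ∈ K,
      ((k : GLm p 2) : Mat p 2).mulVec a = v) :
    ¬ ∃ c : Mat p 2 → ℂ, (∀ M, 1 < M.rank → c M = 0) ∧
      (∑ M, c M * ZMod.stdAddChar (Matrix.trace (M * ((1 : GLm p 2) : Mat p 2)))) = 1 ∧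
      ∀ a ∈ H₁, ∀ b ∈ H₂, ∀ g ∈ H₃, a * b * g ≠ 1 →
        (∑ M, c M *
          ZMod.stdAddChar (Matrix.trace (M * ((a * b * g : GLm p 2) : Mat p 2)))) = 0 := by
  have hmem : ∀ {k : GLm p 2}, k ∈ (K : Set (GLm p 2)).toFinset ↔ k ∈ K := fun {k} => by
    rw [Set.mem_toFinset]; rfl
  refine no_levelOne_design_of_orbit_pair (K : Set (GLm p 2)).toFinset k₀ (hmem.mpr K.one_mem)
    (fun k hk e => hk₀K ?_) (fun k hk _ => ⟨1, H₁.one_mem, 1, H₂.one_mem, k, hKH (hmem.mp hk),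
      by rw [one_mul, one_mul]⟩)
    (fun k hk => ⟨1, H₁.one_mem, k₀, hk₀, k, hKH (hmem.mp hk), by rw [one_mul]⟩)
    (orbitPair_of_transitive K k₀ hfree htrans)
  rw [eq_inv_of_mul_eq_one_left e]
  exact K.inv_mem (hmem.mp hk)

end TransitiveTorus

end Summit.MatrixMultiplication.MatrixMultiplication.Theorems.SubgroupIdentityDesigns.Negative

end
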